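import Literature.RepresentationTheory.BergeronMillsonMoeglin2016.ThetaLiftExhaustion
import HarnessLib

/-!
# Bergeron–Millson–Moeglin 2016: the archimedean signature of a theta lift to `U(p,q)` (end of the proof of
# Thm 7.2, Acta p. 66, after A. Paul) — typed skeleton over `BMMSpectrum`, with the degree-one reading proved

AS PRINTED, N. Bergeron, J. Millson, C. Moeglin, *The Hodge conjecture and arithmetic quotients of complex balls*,
Acta Math. 216 (2016) 1–125 [BergeronMillsonMoeglin2016Balls], end of the proof of Theorem 7.2, p. 66 (Project-Euclid
PDF page 70 L1–5; = arXiv:1306.1515v3, proof of Thm 7.8, chunk p0034 L40): "… that `U(V)(F_v) ≅ U(p,q)`, the signature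
of `W` is `(a,b)`.  But this follows from the explicit description of the Archimedean theta correspondence obtained by
Annegret Paul [61]: the cohomological representation `A(b×q, a×q)` is the image of the local theta correspondence from
a group `U(W, ℂ/ℝ)` with `dim W = a+b` if and only if the signature of `W` is `(a,b)`."  [arXiv wording: "The only
remaining thing to be proved is that the signature at infinity is `(a,b)`: this follows from the fact that
`A(b×q, a×q)` is the image of the local theta correspondance from a group `(W,ℂ/ℝ)` of dimension `a+b` if and only
if the signature is `(a,b)`.  This follows from work of Annegret Paul [Paul]."]  [61] = A. Paul, *Howe correspondence
for real unitary groups*, J. Funct. Anal. 159 (1998) 384–431 [Paul1998] (its Thm 0.1, p. 386, is the equal-rank case).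

WHAT IS REPRODUCED: the sentence, as a TYPED SKELETON over the tree's carriers `BMMSpectrum` of
`Literature/RepresentationTheory/BergeronMillsonMoeglin2016/ThetaLiftExhaustion.lean` (`m = p+q`, `CohInf`,
`A b a = A(b×q, a×q)`, `degreeBound a b` = `3(a+b)+|a−b| < 2m`, the standing hypothesis of Thm 7.2) extended by ONE
local carrier `IsLocalThetaLiftFrom π_∞ (a',b')` = "`π_∞` is the image of the local theta correspondence from a group
`U(W, ℂ/ℝ)` of signature `(a',b')`" (so `dim W = a'+b'`).  NOTHING IS ASSERTED.  PROVED from the typed statement: the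
degree-one reading (`a+b = 1`, `m ≥ 3`): `A(1×q, 0×q)` is a local theta lift from a hermitian LINE of signature
`(a',b')` iff `(a',b') = (0,1)`, and `A(0×q, 1×q)` iff `(a',b') = (1,0)` — lines of the two signatures feed the two
conjugate degree-one types, never the same one.

NOT here: Paul's parametrisation itself (`Literature/…/Adams2007/`, `…/KashiwaraVergne1978/` carry the compact-pair
case), the groups, the global theorem (`BMMSpectrum.Thm_7_2`, `Cor_7_3` in the imported module).

## References

* [BergeronMillsonMoeglin2016Balls] Acta Math. 216 (2016), proof of Thm 7.2, p. 66 (= arXiv:1306.1515 Thm 7.8).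
* [Paul1998] A. Paul, J. Funct. Anal. 159 (1998) 384–431 — BMM's [61].
-/

namespace Literature.RepresentationTheory.BergeronMillsonMoeglin2016

universe u

/-- **[BergeronMillsonMoeglin2016Balls] carriers + the LOCAL theta-image predicate** at the real place `v₀` with
`U(V)(F_{v₀}) ≅ U(p,q)`: `IsLocalThetaLiftFrom π_∞ (a',b')` = "`π_∞` is the image of the local theta correspondence from
a group `U(W, ℂ/ℝ)`" with `W` of signature `(a',b')` (p. 66).  A hypothesis structure extending `BMMSpectrum`: nothing
is asserted. [cite: BergeronMillsonMoeglin2016Balls, proof of Thm 7.2 p. 66] -/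
structure BMMArchSpectrum extends BMMSpectrum.{u} where
  /-- `π_∞` is the image of the local theta correspondence from `U(W, ℂ/ℝ)`, `W` of signature `(a', b')` -/
  IsLocalThetaLiftFrom : toBMMSpectrum.CohInf → ℕ × ℕ → Prop

namespace BMMArchSpectrum

/-- **The archimedean signature of a theta lift**, AS PRINTED [BergeronMillsonMoeglin2016Balls, proof of Thm 7.2,
p. 66]: "the cohomological representation `A(b×q, a×q)` is the image of the local theta correspondence from a group
`U(W, ℂ/ℝ)` with `dim W = a+b` if and only if the signature of `W` is `(a,b)`" (after [Paul1998]).  TYPING: under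
the standing hypothesis `3(a+b)+|a−b| < 2m` of Thm 7.2 (`degreeBound a b`), for all `(a',b')` with `a'+b' = a+b`:
`IsLocalThetaLiftFrom (A b a) (a',b') ↔ (a',b') = (a,b)`.  Nothing is asserted.
[cite: BergeronMillsonMoeglin2016Balls, proof of Thm 7.2 p. 66] -/
def ArchSignature (X : BMMArchSpectrum.{u}) : Prop :=
  ∀ (a b a' b' : ℕ), X.degreeBound a b → a' + b' = a + b →
    (X.IsLocalThetaLiftFrom (X.A b a) (a', b') ↔ (a', b') = (a, b))

/-- DEGREE ONE (`m ≥ 3`): `A(1×q, 0×q)` is a local theta lift from a LINE of signature `(a',b')` iff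
`(a',b') = (0,1)`, and `A(0×q, 1×q)` iff `(a',b') = (1,0)`. [cite: BergeronMillsonMoeglin2016Balls, proof of Thm 7.2 p. 66] -/
theorem archSignature_degree_one {X : BMMArchSpectrum.{u}} (h : X.ArchSignature) (hm : 3 ≤ X.m) {a' b' : ℕ}
    (hab : a' + b' = 1) :
    (X.IsLocalThetaLiftFrom (X.A 1 0) (a', b') ↔ (a', b') = (0, 1)) ∧
    (X.IsLocalThetaLiftFrom (X.A 0 1) (a', b') ↔ (a', b') = (1, 0)) :=
  ⟨h 0 1 a' b' (X.degreeBound_of_add_eq_one (by norm_num) hm) (by omega),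
   h 1 0 a' b' (X.degreeBound_of_add_eq_one (by norm_num) hm) (by omega)⟩

/-- A line of signature `(1,0)` does NOT lift to `A(1×q, 0×q)` (degree one, `m ≥ 3`).
[cite: BergeronMillsonMoeglin2016Balls, proof of Thm 7.2 p. 66] -/
theorem not_isLocalThetaLiftFrom_A10_of_sig10 {X : BMMArchSpectrum.{u}} (h : X.ArchSignature) (hm : 3 ≤ X.m) :
    ¬ X.IsLocalThetaLiftFrom (X.A 1 0) (1, 0) := by
  intro hl
  have := ((archSignature_degree_one h hm (a' := 1) (b' := 0) rfl).1).1 hl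
  simp at this

/-- Symmetrically, a line of signature `(0,1)` does NOT lift to `A(0×q, 1×q)`.
[cite: BergeronMillsonMoeglin2016Balls, proof of Thm 7.2 p. 66] -/
theorem not_isLocalThetaLiftFrom_A01_of_sig01 {X : BMMArchSpectrum.{u}} (h : X.ArchSignature) (hm : 3 ≤ X.m) :
    ¬ X.IsLocalThetaLiftFrom (X.A 0 1) (0, 1) := by
  intro hl
  have := ((archSignature_degree_one h hm (a' := 0) (b' := 1) rfl).2).1 hl
  simp at this

/-- The two degree-one types are fed by lines of DIFFERENT signatures: if one line signature `(a',b')`, `a'+b' = 1`,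
lifts to both `A(1×q,0×q)` and `A(0×q,1×q)`, contradiction. [cite: BergeronMillsonMoeglin2016Balls, proof of Thm 7.2 p. 66] -/
theorem not_both_degree_one {X : BMMArchSpectrum.{u}} (h : X.ArchSignature) (hm : 3 ≤ X.m) {a' b' : ℕ}
    (hab : a' + b' = 1) (h10 : X.IsLocalThetaLiftFrom (X.A 1 0) (a', b'))
    (h01 : X.IsLocalThetaLiftFrom (X.A 0 1) (a', b')) : False := by
  have h1 := ((archSignature_degree_one h hm hab).1).1 h10
  have h2 := ((archSignature_degree_one h hm hab).2).1 h01
  rw [h1] at h2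
  simp at h2

end BMMArchSpectrum

end Literature.RepresentationTheory.BergeronMillsonMoeglin2016
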